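import Mathlib
import Summits.Ventures.PercRepro2.Defs
import Summits.Ventures.PercRepro2.Harris
import Summits.Ventures.PercRepro2.Graph
import Summits.Ventures.PercRepro2.Exploration
import Summits.Ventures.PercRepro2.Events
import Summits.Ventures.PercRepro2.CutVertexDefs
import Summits.Ventures.PercRepro2.CDCutVertex
import Summits.Ventures.PercRepro2.TCutVertex

/-!
# (T_h) across a cut vertex with the two up-sets on different sides: a THEOREM
(blind cell PercRepro2, mine-a g46; MINE-A.md §101.5 (e))

Cut vertex `x` (`CutV.IsCut ends x VA VB EA EB`), root `s ∈ VA`, hit vertex `h ∈ VB`, the up-set `𝓤`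
read beyond the cut (`S ∈ 𝓤 ↔ S ∩ VB ∈ 𝓤`, `∅ ∉ 𝓤`) and the up-set `𝓥` read on the root side
(`S ∈ 𝓥 ↔ S ∩ (VA ∪ {x}) ∈ 𝓥`).  Then `Q = {s ↔ x in A} ∩ {h ∈ C_x in B}`,
`U = {s ↔ x in A} ∩ {C_x ∈ 𝓤 in B}` (`TCutVertex.hit_eq`, `clusterInEvent_eq`) and `e` is the
`A`-side event `{C_s ∈ 𝓥 inside A}` (`clusterInEvent_eq_side'`); the two products `P(Q) P(U ∩ e)`
and `P(Q ∩ e) P(U)` of the (T)-form coincide and cancel, and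

  **`T(p; s, h) = P_{p_B}(h ∈ C_x, C_x ∈ 𝓤) · Cov_{p_A}({s ↔ x}, {C_s ∈ 𝓥})`**   (`t_cut_mixed_identity`),

which is `≥ 0` by Harris on the `A`-side (`t_of_cut_mixed`): **(T_h) holds unconditionally whenever
the two up-sets are read on opposite sides of a cut vertex separating the root from the hit vertex**
(and, by the symmetry of the (T)-form in `U`, `e`, with the roles of the up-sets exchanged).
Exact check in Fractions on 36 random glued multigraphs, 0 mismatches (data/mine-a/g46/codes).
No definition; one seat.
-/

namespace Summit.Ventures.PercRepro2

namespace TCutVertexMixed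

open CutV

variable {V : Type*} {E : Type*} [Fintype E] [DecidableEq E]
  {R : Type*} [Field R] [LinearOrder R] [IsStrictOrderedRing R]
variable {ends : E → Sym2 V} {x : V} {VA VB : Set V} {EA EB : Set E}
  [DecidablePred (· ∈ EA)] [DecidablePred (· ∈ EB)]

omit [Fintype E] [DecidableEq E] [Field R] [LinearOrder R] [IsStrictOrderedRing R]
  [DecidablePred (· ∈ EB)] in
/-- A cluster event read on the root side is an `A`-side event (`TCutVertexNear`'s lemma, restated
so that this file does not wait for its olean). -/
lemma clusterInEvent_eq_side' (h : IsCut ends x VA VB EA EB) {s : V} (hs : s ∈ VA)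
    {𝓥 : Set (Set V)} (h𝓥 : ∀ S, S ∈ 𝓥 ↔ S ∩ (VA ∪ {x}) ∈ 𝓥) :
    clusterInEvent ends s 𝓥 = sideEvent EA (clusterInEvent ends s 𝓥) := by
  ext ω
  simp only [mem_clusterInEvent, mem_sideEvent]
  rw [h𝓥 (cluster ends ω s), cluster_inter_eq h (Or.inl hs)]

omit [LinearOrder R] [IsStrictOrderedRing R] in
/-- `P({A-side event} ∩ {B-side event}) = P_{p_A}(·) · P_{p_B}(·)`. -/
lemma prob_side_inter_side' (p : E → R) (h : IsCut ends x VA VB EA EB) (X Y : Set (Config E)) :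
    prob p (sideEvent EA X ∩ sideEvent EB Y) =
      prob (fun e => if e ∈ EA then p e else 0) X * prob (fun e => if e ∈ EB then p e else 0) Y := by
  rw [prob_sideEvent_inter_eq_mul p h, CDCutVertex.prob_zeroOff_eq_prob_sideEvent p EA X,
    CDCutVertex.prob_zeroOff_eq_prob_sideEvent p EB Y]

omit [LinearOrder R] [IsStrictOrderedRing R] in
/-- **The (T)-form with the up-sets on opposite sides of the cut**:
`T = P_{p_B}(Q_B ∩ U_B) · (P_{p_A}(X ∩ e_A) − P_{p_A}(X) P_{p_A}(e_A))`, `X = {s ↔ x}`. -/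
theorem t_cut_mixed_identity (p : E → R) (h : IsCut ends x VA VB EA EB) {s hv : V} (hs : s ∈ VA)
    (hvB : hv ∈ VB) {𝓤 𝓥 : Set (Set V)} (h𝓤 : ∀ S, S ∈ 𝓤 ↔ S ∩ VB ∈ 𝓤) (h𝓤0 : ∅ ∉ 𝓤)
    (h𝓥 : ∀ S, S ∈ 𝓥 ↔ S ∩ (VA ∪ {x}) ∈ 𝓥) :
    prob p (clusterInEvent ends s {T : Set V | hv ∈ T} ∩ clusterInEvent ends s 𝓤 ∩
        clusterInEvent ends s 𝓥) +
      prob p (clusterInEvent ends s {T : Set V | hv ∈ T}) *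
        prob p (clusterInEvent ends s 𝓤 ∩ clusterInEvent ends s 𝓥) -
      prob p (clusterInEvent ends s {T : Set V | hv ∈ T} ∩ clusterInEvent ends s 𝓤) *
        prob p (clusterInEvent ends s 𝓥) -
      prob p (clusterInEvent ends s {T : Set V | hv ∈ T} ∩ clusterInEvent ends s 𝓥) *
        prob p (clusterInEvent ends s 𝓤) =
    prob (fun e => if e ∈ EB then p e else 0)
        (clusterInEvent ends x {T : Set V | hv ∈ T} ∩ clusterInEvent ends x 𝓤) *
      (prob (fun e => if e ∈ EA then p e else 0) (connEvent ends s x ∩ clusterInEvent ends s 𝓥) -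
        prob (fun e => if e ∈ EA then p e else 0) (connEvent ends s x) *
          prob (fun e => if e ∈ EA then p e else 0) (clusterInEvent ends s 𝓥)) := by
  have hQ := TCutVertex.hit_eq (EA := EA) h hs hvB
  have hU := TCutVertex.clusterInEvent_eq (EA := EA) h hs h𝓤 h𝓤0
  have hE := clusterInEvent_eq_side' (EB := EB) h hs h𝓥
  -- membership forms (no rewriting of the right-hand side)
  have mQ : ∀ ω, ω ∈ clusterInEvent ends s {T : Set V | hv ∈ T} ↔
      (restrict EA ω ∈ connEvent ends s x ∧
        restrict EB ω ∈ clusterInEvent ends x {T : Set V | hv ∈ T}) := fun ω => by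
    rw [hQ]; exact Iff.rfl
  have mU : ∀ ω, ω ∈ clusterInEvent ends s 𝓤 ↔
      (restrict EA ω ∈ connEvent ends s x ∧ restrict EB ω ∈ clusterInEvent ends x 𝓤) := fun ω => by
    rw [hU]; exact Iff.rfl
  have mE : ∀ ω, ω ∈ clusterInEvent ends s 𝓥 ↔ restrict EA ω ∈ clusterInEvent ends s 𝓥 := fun ω => by
    simp only [mem_clusterInEvent]
    rw [h𝓥 (cluster ends ω s), cluster_inter_eq h (Or.inl hs)]
  have s1 : clusterInEvent ends s {T : Set V | hv ∈ T} ∩ clusterInEvent ends s 𝓤 ∩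
      clusterInEvent ends s 𝓥 =
      sideEvent EA (connEvent ends s x ∩ clusterInEvent ends s 𝓥) ∩
        sideEvent EB (clusterInEvent ends x {T : Set V | hv ∈ T} ∩ clusterInEvent ends x 𝓤) := by
    ext ω
    simp only [Set.mem_inter_iff, mem_sideEvent]
    rw [mQ ω, mU ω, mE ω]; tauto
  have s2 : clusterInEvent ends s {T : Set V | hv ∈ T} =
      sideEvent EA (connEvent ends s x) ∩
        sideEvent EB (clusterInEvent ends x {T : Set V | hv ∈ T}) := hQ
  have s3 : clusterInEvent ends s 𝓤 ∩ clusterInEvent ends s 𝓥 =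
      sideEvent EA (connEvent ends s x ∩ clusterInEvent ends s 𝓥) ∩
        sideEvent EB (clusterInEvent ends x 𝓤) := by
    ext ω
    simp only [Set.mem_inter_iff, mem_sideEvent]
    rw [mU ω, mE ω]; tauto
  have s4 : clusterInEvent ends s {T : Set V | hv ∈ T} ∩ clusterInEvent ends s 𝓤 =
      sideEvent EA (connEvent ends s x) ∩
        sideEvent EB (clusterInEvent ends x {T : Set V | hv ∈ T} ∩ clusterInEvent ends x 𝓤) := by
    ext ω
    simp only [Set.mem_inter_iff, mem_sideEvent]
    rw [mQ ω, mU ω]; tauto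
  have s5 : clusterInEvent ends s 𝓥 = sideEvent EA (clusterInEvent ends s 𝓥) := hE
  have s6 : clusterInEvent ends s {T : Set V | hv ∈ T} ∩ clusterInEvent ends s 𝓥 =
      sideEvent EA (connEvent ends s x ∩ clusterInEvent ends s 𝓥) ∩
        sideEvent EB (clusterInEvent ends x {T : Set V | hv ∈ T}) := by
    ext ω
    simp only [Set.mem_inter_iff, mem_sideEvent]
    rw [mQ ω, mE ω]; tauto
  have s7 : clusterInEvent ends s 𝓤 =
      sideEvent EA (connEvent ends s x) ∩ sideEvent EB (clusterInEvent ends x 𝓤) := hU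
  have p1 := congrArg (prob p) s1
  have p2 := congrArg (prob p) s2
  have p3 := congrArg (prob p) s3
  have p4 := congrArg (prob p) s4
  have p5 := congrArg (prob p) s5
  have p6 := congrArg (prob p) s6
  have p7 := congrArg (prob p) s7
  rw [prob_side_inter_side' p h] at p1 p2 p3 p4 p6 p7
  rw [← CDCutVertex.prob_zeroOff_eq_prob_sideEvent p EA] at p5
  rw [p1, p4, p6, p2, p3, p5, p7]
  ring

/-- **(T_h) is a theorem when the two up-sets are read on opposite sides of a cut vertex
separating the root from the hit vertex** (Harris on the root side). -/
theorem t_of_cut_mixed (p : E → R) (hp : IsProbVec p) (h : IsCut ends x VA VB EA EB) {s hv : V}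
    (hs : s ∈ VA) (hvB : hv ∈ VB) {𝓤 𝓥 : Set (Set V)} (h𝓤 : ∀ S, S ∈ 𝓤 ↔ S ∩ VB ∈ 𝓤)
    (h𝓤0 : ∅ ∉ 𝓤) (h𝓥 : ∀ S, S ∈ 𝓥 ↔ S ∩ (VA ∪ {x}) ∈ 𝓥) (h𝓥up : IsUpperSet 𝓥) :
    prob p (clusterInEvent ends s {T : Set V | hv ∈ T} ∩ clusterInEvent ends s 𝓤) *
        prob p (clusterInEvent ends s 𝓥) +
      prob p (clusterInEvent ends s 𝓤) *
        prob p (clusterInEvent ends s {T : Set V | hv ∈ T} ∩ clusterInEvent ends s 𝓥) ≤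
      prob p (clusterInEvent ends s {T : Set V | hv ∈ T} ∩ clusterInEvent ends s 𝓤 ∩
          clusterInEvent ends s 𝓥) +
        prob p (clusterInEvent ends s {T : Set V | hv ∈ T}) *
          prob p (clusterInEvent ends s 𝓤 ∩ clusterInEvent ends s 𝓥) := by
  have hid := t_cut_mixed_identity p h hs hvB h𝓤 h𝓤0 h𝓥
  have hpA : IsProbVec (fun e => if e ∈ EA then p e else 0) := CDCutVertex.isProbVec_zeroOff hp EA
  have hpB : IsProbVec (fun e => if e ∈ EB then p e else 0) := CDCutVertex.isProbVec_zeroOff hp EB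
  have hq : 0 ≤ prob (fun e => if e ∈ EB then p e else 0)
      (clusterInEvent ends x {T : Set V | hv ∈ T} ∩ clusterInEvent ends x 𝓤) := prob_nonneg hpB _
  have hH : prob (fun e => if e ∈ EA then p e else 0) (connEvent ends s x) *
      prob (fun e => if e ∈ EA then p e else 0) (clusterInEvent ends s 𝓥) ≤
      prob (fun e => if e ∈ EA then p e else 0) (connEvent ends s x ∩ clusterInEvent ends s 𝓥) :=
    prob_mul_prob_le_prob_inter hpA (isUpperSet_connEvent ends s x)
      (isUpperSet_clusterInEvent ends s h𝓥up)
  nlinarith [mul_nonneg hq (sub_nonneg.2 hH)]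

end TCutVertexMixed

end Summit.Ventures.PercRepro2
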